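import Mathlib.Algebra.Order.Field.Basic
import Mathlib.Algebra.Order.BigOperators.Group.Finset
import Mathlib.Tactic.Ring
import Mathlib.Tactic.Linarith
import Mathlib.Tactic.Positivity
import Mathlib.Tactic.FieldSimp
import Mathlib.Tactic.IntervalCases
import Mathlib.Data.Nat.Log
import Literature.ComputerArithmetic.SaoEtAl2026.ReductionTrees
import HarnessLib

/-!
# Sao et al. 2026 Prop. 3.1 (Λ₁-extrema of full binary reduction trees) — `Shape.Lambda1Extrema` and `Shape.Lambda1ExtremaAttained` HOLD (re-homed proofs)

**Sao–Miniskar–Valero-Lara–Teranishi–Seal 2026, Prop. 3.1 (Λ₁-extrema of reduction trees) — BOTH named facts of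
`Literature/ComputerArithmetic/SaoEtAl2026/ReductionTrees.lean` HOLD**: `Shape.Lambda1Extrema` (every full binary tree with `k` leaves has
`k⌊log₂ k⌋ + 2(k − 2^⌊log₂ k⌋) ≤ Λ₁ ≤ k(k+1)/2 − 1`) and `Shape.Lambda1ExtremaAttained` (the halving tree attains the minimum, the
sequential tree the maximum) — P. Sao, N. Miniskar, P. Valero-Lara, K. Teranishi, S. Seal, *A Second-Moment Theory for Floating-Point
Reduction Trees*, arXiv:2607.18758 (2026), Prop. 3.1: «Among full binary trees with `k` leaves, `Λ₁^min(k) = k⌊log₂ k⌋ + 2(k − 2^⌊log₂ k⌋)`,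
`Λ₁^max(k) = k(k+1)/2 − 1`. Nearly complete balanced trees attain the minimum; the sequential tree attains the maximum.» [SaoEtAl2026]
(the minimum external path length of a binary tree is classical: Knuth, TAOCP Vol. 3, §5.3.1).  The in-tree proof is elementary
combinatorics (the halving recursion `optEpl`, its closed form, balancing, induction on the tree) and lived on the Summits side only
(`Summits/Ventures/CertifiedArithmetic/LowPrec/SRSaoBridge.lean`: `SR.lambda1Extrema_holds`, `SR.lambda1ExtremaAttained_holds`).
RE-HOMED into `Literature/` by the Hodge foundations lane (`lit-hodgefound`, seat p20, generation 38): verbatim DECLARATION-LEVEL ports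
(the declarations needed, in dependency order) of `Summits/Ventures/CertifiedArithmetic/LowPrec/{SRTree (2 of 41 declarations: the
inductive `STree`, `STree.leaves`), SRTreeDesign (3 of 26: `pairwise`, `leaves_pos`, `leaves_pairwise`), SRTreeExtremal (11 of 18),
SRSaoBridge (5 of 11)}.lean`, namespace `Summit.Ventures.CertifiedArithmetic.LowPrec.SR` re-rooted as
`Literature.ComputerArithmetic.SaoEtAl2026.SummationTree`, followed by the EXACT-name discharges
`Literature.ComputerArithmetic.SaoEtAl2026.Shape.Lambda1Extrema_holds` and `….Shape.Lambda1ExtremaAttained_holds`.  Definitions come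
with their bodies (`STree`, `STree.leaves`, `pairwise`, `epl`, `optEpl`, `ofShape` — 3–7 lines each); no new named fact (D-0026), no
Summits import, Mathlib-elementary imports only.  The Summits originals stay in place (transitional duplication).  WHAT THIS IS NOT:
nothing about floating-point error envelopes or any rounding model; this is the combinatorics of external path length.
-/

noncomputable section

/-!
## Part 1 — port of `Summits/Ventures/CertifiedArithmetic/LowPrec/SRTree.lean` (2 declarations kept)

# Summation trees (two bookkeeping declarations)

`STree K` — a full binary tree whose leaves carry labels in `K` (an evaluation order of `∑ xᵢ`) — and `STree.leaves`, the number of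
leaves.  (The source module's floating-point content is not re-homed.)  Reference: [SaoEtAl2026, §2.1].
-/

section Part1

namespace Literature.ComputerArithmetic.SaoEtAl2026.SummationTree

open _root_.Finset

/-! ### Summation trees -/

/-- A summation tree (an evaluation order of `∑ xᵢ`): leaves carry the exact summands, every
internal node is one floating-point addition (here: one stochastic rounding).
[cite: SaoEtAl2026, §2.1 (summation trees; bookkeeping)] -/
inductive STree (K : Type*) where
  | leaf : K → STree K
  | node : STree K → STree K → STree K

namespace STree

variable {K : Type*}

/-- Number of leaves (summands). [cite: SaoEtAl2026, §2.1 (summation trees; bookkeeping)] -/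
def leaves : STree K → ℕ
  | leaf _ => 1
  | node l r => leaves l + leaves r

end STree

open STree

end Literature.ComputerArithmetic.SaoEtAl2026.SummationTree

end Part1

/-!
## Part 2 — port of `Summits/Ventures/CertifiedArithmetic/LowPrec/SRTreeDesign.lean` (3 declarations kept)

# The pairwise (halving) summation tree

`pairwise x o n` — the halving tree on the `n` summands `x o, …, x (o + n − 1)` — with `leaves_pos` and `leaves_pairwise`.
(The source module's variance-design content is not re-homed.)  Reference: [SaoEtAl2026, §2.4].
-/

section Part2

namespace Literature.ComputerArithmetic.SaoEtAl2026.SummationTree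

open _root_.Finset STree

/-! ### The shape statistic and the candidate optimum -/

/-- PAIRWISE SUMMATION of `x o, …, x (o + n − 1)` as a tree: halve (`⌊n/2⌋` left, `⌈n/2⌉` right)
and recurse; `n ≤ 1` is the single leaf `x o`. [cite: Higham2002ASNA, §4.1] -/
def pairwise {K : Type*} (x : ℕ → K) : ℕ → ℕ → STree K
  | o, 0 => .leaf (x o)
  | o, 1 => .leaf (x o)
  | o, n + 2 => .node (pairwise x o ((n + 2) / 2)) (pairwise x (o + (n + 2) / 2) ((n + 3) / 2))
decreasing_by all_goals omega

/-- Every tree has at least one leaf. [cite: SaoEtAl2026, §2.4 (pairwise / halving tree; bookkeeping)] -/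
theorem leaves_pos {K : Type*} : ∀ t : STree K, 1 ≤ t.leaves
  | .leaf _ => le_rfl
  | .node l _ => le_add_right (leaves_pos l)

/-- The pairwise tree on `n ≥ 1` summands has `n` leaves.
[cite: SaoEtAl2026, §2.4 (pairwise / halving tree; bookkeeping)] -/
theorem leaves_pairwise {K : Type*} (x : ℕ → K) : ∀ (n o : ℕ), 1 ≤ n →
    (pairwise x o n).leaves = n := by
  intro n
  induction n using Nat.strong_induction_on with
  | _ n ih =>
    intro o hn
    rcases Nat.lt_or_ge n 2 with h | h
    · obtain rfl : n = 1 := by omega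
      simp [pairwise, STree.leaves]
    · obtain ⟨m, rfl⟩ : ∃ m, n = m + 2 := ⟨n - 2, by omega⟩
      rw [pairwise, STree.leaves, ih ((m + 2) / 2) (by omega) _ (by omega),
        ih ((m + 3) / 2) (by omega) _ (by omega)]
      omega

end Literature.ComputerArithmetic.SaoEtAl2026.SummationTree

end Part2

/-!
## Part 3 — port of `Summits/Ventures/CertifiedArithmetic/LowPrec/SRTreeExtremal.lean` (11 declarations kept)

# `Λ₁` (external path length) of a summation tree: the halving recursion is optimal, the comb is pessimal

`epl` (`Λ₁(T) = Σ_{v internal} |L(v)|`, [SaoEtAl2026, Cor. 2.5 (11)]), `optEpl n = n + optEpl ⌊n/2⌋ + optEpl ⌈n/2⌉`, its closed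
form `optEpl n = n(L+2) − 2^{L+1}` for `2^L ≤ n ≤ 2^{L+1}` (`optEpl_closed`), monotonicity of increments and the balancing
inequality (`optEpl_balance`), whence `optEpl (leaves T) ≤ epl T` for EVERY tree (`optEpl_le_epl`: induction on the tree, using
the balancing inequality at the root), `epl (pairwise …) = optEpl n` (`epl_pairwise`), and the sequential upper bound
`2·epl T + 2 ≤ k(k+1)` (`two_mul_epl_le`).  This is the combinatorial content of Sao et al. Prop. 3.1 (Λ₁-extrema: «Among full
binary trees with k leaves, Λ₁^min(k) = k⌊log₂ k⌋ + 2(k − 2^⌊log₂ k⌋), Λ₁^max(k) = k(k+1)/2 − 1»; classical: Knuth, TAOCP §5.3.1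
eq. (34) for the minimum external path length).  Reference: [SaoEtAl2026, Prop. 3.1].
-/

section Part3

namespace Literature.ComputerArithmetic.SaoEtAl2026.SummationTree

open _root_.Finset

/-! ### `Λ₁`: external path length -/

/-- `Λ₁(T)`: the sum over the internal nodes of the number of leaves below the node — equivalently
the total depth of the leaves (external path length) [cite: SaoEtAl2026, Cor. 2.5, (11)]. -/
def epl {K : Type*} : STree K → ℕ
  | .leaf _ => 0
  | .node l r => (l.leaves + r.leaves) + epl l + epl r

/-- The minimal external path length by halving: `optEpl n = n + optEpl ⌊n/2⌋ + optEpl ⌈n/2⌉`.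
[cite: SaoEtAl2026, Prop. 3.1 (Λ₁-extrema: the halving recursion optEpl, its closed form, optimality and the sequential upper bound)] -/
def optEpl : ℕ → ℕ
  | 0 => 0
  | 1 => 0
  | n + 2 => (n + 2) + optEpl ((n + 2) / 2) + optEpl ((n + 3) / 2)
decreasing_by all_goals omega

/-- The defining equation of `optEpl` for `n ≥ 2`.
[cite: SaoEtAl2026, Prop. 3.1 (Λ₁-extrema: the halving recursion optEpl, its closed form, optimality and the sequential upper bound)] -/
theorem optEpl_eq {n : ℕ} (hn : 2 ≤ n) :
    optEpl n = n + optEpl (n / 2) + optEpl ((n + 1) / 2) := by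
  obtain ⟨m, rfl⟩ : ∃ m, n = m + 2 := ⟨n - 2, by omega⟩
  rw [optEpl]

/-- **Closed form**: `optEpl n + 2^(L+1) = n·(L+2)` whenever `2^L ≤ n ≤ 2^(L+1)` (both bracketing
exponents give the same value at powers of two).  With `L = ⌊log₂ n⌋` this is
`optEpl n = n⌊log₂ n⌋ + 2(n − 2^⌊log₂ n⌋)` [cite: SaoEtAl2026, Prop. 3.1]. -/
theorem optEpl_closed : ∀ (L n : ℕ), 2 ^ L ≤ n → n ≤ 2 ^ (L + 1) →
    optEpl n + 2 ^ (L + 1) = n * (L + 2) := by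
  intro L
  induction L with
  | zero =>
      intro n h1 h2
      interval_cases n <;> simp [optEpl]
  | succ L ih =>
      intro n h1 h2
      have p1 : 2 ^ (L + 1) = 2 * 2 ^ L := by ring
      have p2 : 2 ^ (L + 1 + 1) = 4 * 2 ^ L := by ring
      rw [p1] at h1
      rw [p2] at h2
      have hpos : 1 ≤ 2 ^ L := Nat.one_le_two_pow
      have hn : 2 ≤ n := by omega
      rw [optEpl_eq hn]
      have hl := ih (n / 2) (by omega) (by rw [p1]; omega)
      have hr := ih ((n + 1) / 2) (by omega) (by rw [p1]; omega)
      have e : n / 2 + (n + 1) / 2 = n := by omega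
      calc n + optEpl (n / 2) + optEpl ((n + 1) / 2) + 2 ^ (L + 1 + 1)
          = n + (optEpl (n / 2) + 2 ^ (L + 1)) + (optEpl ((n + 1) / 2) + 2 ^ (L + 1)) := by ring
        _ = n + n / 2 * (L + 2) + (n + 1) / 2 * (L + 2) := by rw [hl, hr]
        _ = n + (n / 2 + (n + 1) / 2) * (L + 2) := by ring
        _ = n * (L + 1 + 2) := by rw [e]; ring

/-- **Increments**: `optEpl (n+1) = optEpl n + ⌊log₂ n⌋ + 2` for `n ≥ 1`.
[cite: SaoEtAl2026, Prop. 3.1 (Λ₁-extrema: the halving recursion optEpl, its closed form, optimality and the sequential upper bound)] -/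
theorem optEpl_succ {n : ℕ} (hn : 1 ≤ n) : optEpl (n + 1) = optEpl n + Nat.log 2 n + 2 := by
  set L := Nat.log 2 n with hL
  have h1 : 2 ^ L ≤ n := Nat.pow_log_le_self 2 (by omega)
  have h2 : n < 2 ^ (L + 1) := Nat.lt_pow_succ_log_self (by norm_num) n
  have ha := optEpl_closed L n h1 h2.le
  have hb := optEpl_closed L (n + 1) (by omega) (by omega)
  have : optEpl (n + 1) + 2 ^ (L + 1) = optEpl n + 2 ^ (L + 1) + (L + 2) := by
    rw [hb, ha]; ring
  omega

/-- The increments `optEpl (k+1) − optEpl k` are nondecreasing in `k`.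
[cite: SaoEtAl2026, Prop. 3.1 (Λ₁-extrema: the halving recursion optEpl, its closed form, optimality and the sequential upper bound)] -/
theorem optEpl_inc_mono : Monotone (fun k => (optEpl (k + 1) : ℤ) - optEpl k) := by
  refine monotone_nat_of_le_succ fun k => ?_
  rcases Nat.eq_zero_or_pos k with rfl | hk
  · simp [optEpl]
  · change (optEpl (k + 1) : ℤ) - optEpl k ≤ (optEpl (k + 1 + 1) : ℤ) - optEpl (k + 1)
    rw [optEpl_succ (n := k + 1) (by omega), optEpl_succ hk]
    have := Nat.log_mono_right (b := 2) (show k ≤ k + 1 by omega)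
    push_cast; omega

/-! ### A generic balancing lemma (the exchange argument) -/

/-- **Balancing from convexity.** If `f : ℕ → ℕ` has nondecreasing increments then the balanced
split minimises `f i + f j` over `i + j` fixed: `f ⌊(i+j)/2⌋ + f ⌈(i+j)/2⌉ ≤ f i + f j`.
[cite: SaoEtAl2026, Prop. 3.1 (Λ₁-extrema: the halving recursion optEpl, its closed form, optimality and the sequential upper bound)] -/
theorem balance_of_inc_mono (f : ℕ → ℕ) (hf : Monotone (fun k => (f (k + 1) : ℤ) - f k)) :
    ∀ (d i j : ℕ), j = i + d → f ((i + j) / 2) + f ((i + j + 1) / 2) ≤ f i + f j := by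
  intro d
  induction d using Nat.strong_induction_on with
  | _ d ih =>
    intro i j hj
    rcases Nat.lt_or_ge d 2 with hd | hd
    · have e1 : (i + j) / 2 = i := by omega
      have e2 : (i + j + 1) / 2 = j := by omega
      rw [e1, e2]
    · have h := ih (d - 2) (by omega) (i + 1) (j - 1) (by omega)
      have e1 : (i + 1 + (j - 1)) / 2 = (i + j) / 2 := by omega
      have e2 : (i + 1 + (j - 1) + 1) / 2 = (i + j + 1) / 2 := by omega
      rw [e1, e2] at h
      -- exchange: `f (i+1) + f (j-1) ≤ f i + f j` from the monotone increments at `i ≤ j - 1`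
      have hx : (f (i + 1) : ℤ) - f i ≤ (f (j - 1 + 1) : ℤ) - f (j - 1) :=
        hf (show i ≤ j - 1 by omega)
      have e3 : j - 1 + 1 = j := by omega
      rw [e3] at hx
      omega

/-- The balanced split for `Λ₂`'s recursion, re-derived from the generic lemma (cf.
`SR.optSq_balance`).
[cite: SaoEtAl2026, Prop. 3.1 (Λ₁-extrema: the halving recursion optEpl, its closed form, optimality and the sequential upper bound)] -/
theorem optEpl_balance (d i j : ℕ) (h : j = i + d) :
    optEpl ((i + j) / 2) + optEpl ((i + j + 1) / 2) ≤ optEpl i + optEpl j :=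
  balance_of_inc_mono optEpl optEpl_inc_mono d i j h

/-! ### `Λ₁` minimum: every tree, attained by the pairwise tree -/

/-- **`Λ₁` lower bound (every binary tree).** `optEpl (leaves T) ≤ epl T`.
[cite: SaoEtAl2026, Prop. 3.1 (Λ₁-extrema: the halving recursion optEpl, its closed form, optimality and the sequential upper bound)] -/
theorem optEpl_le_epl {K : Type*} : ∀ t : STree K, optEpl t.leaves ≤ epl t
  | .leaf _ => by simp [STree.leaves, epl, optEpl]
  | .node l r => by
      have hl := optEpl_le_epl l
      have hr := optEpl_le_epl r
      have h1 := leaves_pos l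
      have h2 := leaves_pos r
      simp only [STree.leaves, epl]
      rw [optEpl_eq (by omega)]
      have hb := optEpl_balance (l.leaves + r.leaves - 2 * min l.leaves r.leaves)
        (min l.leaves r.leaves) (max l.leaves r.leaves) (by omega)
      rw [min_add_max] at hb
      have e2 : optEpl (min l.leaves r.leaves) + optEpl (max l.leaves r.leaves)
          = optEpl l.leaves + optEpl r.leaves := by
        rcases le_total l.leaves r.leaves with h | h
        · rw [min_eq_left h, max_eq_right h]
        · rw [min_eq_right h, max_eq_left h, add_comm]
      omega

/-- The pairwise tree attains it: `epl (pairwise x o n) = optEpl n` (`n ≥ 1`).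
[cite: SaoEtAl2026, Prop. 3.1 (Λ₁-extrema: the halving recursion optEpl, its closed form, optimality and the sequential upper bound)] -/
theorem epl_pairwise {K : Type*} (x : ℕ → K) : ∀ (n o : ℕ), 1 ≤ n →
    epl (pairwise x o n) = optEpl n := by
  intro n
  induction n using Nat.strong_induction_on with
  | _ n ih =>
    intro o hn
    rcases Nat.lt_or_ge n 2 with h | h
    · obtain rfl : n = 1 := by omega
      simp [pairwise, epl, optEpl]
    · obtain ⟨m, rfl⟩ : ∃ m, n = m + 2 := ⟨n - 2, by omega⟩
      rw [pairwise, epl, optEpl, leaves_pairwise x _ _ (by omega), leaves_pairwise x _ _ (by omega),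
        ih ((m + 2) / 2) (by omega) _ (by omega), ih ((m + 3) / 2) (by omega) _ (by omega)]
      have e : (m + 2) / 2 + (m + 3) / 2 = m + 2 := by omega
      rw [e]

/-- **`Λ₁` upper bound (every binary tree)**: `2·epl T + 2 ≤ n(n+1)`, `n` = number of leaves.
[cite: SaoEtAl2026, Prop. 3.1 (Λ₁-extrema: the halving recursion optEpl, its closed form, optimality and the sequential upper bound)] -/
theorem two_mul_epl_le {K : Type*} : ∀ t : STree K,
    2 * epl t + 2 ≤ t.leaves * (t.leaves + 1)
  | .leaf _ => by simp [epl, STree.leaves]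
  | .node l r => by
      have hl := two_mul_epl_le l
      have hr := two_mul_epl_le r
      have h1 := leaves_pos l
      have h2 := leaves_pos r
      simp only [epl, STree.leaves]
      nlinarith [Nat.mul_le_mul h1 h2]

end Literature.ComputerArithmetic.SaoEtAl2026.SummationTree

end Part3

/-!
## Part 4 — port of `Summits/Ventures/CertifiedArithmetic/LowPrec/SRSaoBridge.lean` (5 declarations kept)

# Transport `Shape ↦ STree Unit` and the closed form at `L = ⌊log₂ n⌋`

`ofShape` (a tree shape as a summation tree with unit labels; `Λ₁ = epl`, `size = leaves`), `ofShape_halving` (the halving shape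
is the pairwise tree) and `optEpl_eq_log` (`optEpl n = n⌊log₂ n⌋ + 2(n − 2^⌊log₂ n⌋)`).  Reference: [SaoEtAl2026, Prop. 3.1].
-/

section Part4

namespace Literature.ComputerArithmetic.SaoEtAl2026.SummationTree

open Literature.ComputerArithmetic.SaoEtAl2026

/-- Transport: a tree shape as a summation tree with unit labels.
[cite: SaoEtAl2026, Prop. 3.1 (transport Shape ↦ summation tree)] -/
def ofShape : Shape → STree Unit
  | .leaf => .leaf ()
  | .node l r => .node (ofShape l) (ofShape r)

/-- `ofShape` preserves the number of leaves. [cite: SaoEtAl2026, Prop. 3.1 (transport Shape ↦ summation tree)] -/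
theorem leaves_ofShape : ∀ T : Shape, (ofShape T).leaves = T.size
  | .leaf => rfl
  | .node l r => by simp [ofShape, STree.leaves, Shape.size, leaves_ofShape l, leaves_ofShape r]

/-- `Λ₁` is the external path length `SR.epl`. [cite: SaoEtAl2026, Prop. 3.1 (transport Shape ↦ summation tree)] -/
theorem epl_ofShape : ∀ T : Shape, epl (ofShape T) = T.lambda1
  | .leaf => rfl
  | .node l r => by
      simp [ofShape, epl, Shape.lambda1, epl_ofShape l, epl_ofShape r, leaves_ofShape]

/-- The halving shape is the pairwise summation tree.
[cite: SaoEtAl2026, Prop. 3.1 (transport Shape ↦ summation tree)] -/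
theorem ofShape_halving : ∀ (n o : ℕ), ofShape (Shape.halving n) = pairwise (fun _ => ()) o n := by
  intro n
  induction n using Nat.strong_induction_on with
  | _ n ih =>
    intro o
    rcases Nat.lt_or_ge n 2 with h | h
    · interval_cases n <;> simp [Shape.halving, pairwise, ofShape]
    · obtain ⟨m, rfl⟩ : ∃ m, n = m + 2 := ⟨n - 2, by omega⟩
      rw [Shape.halving, pairwise, ofShape, ih ((m + 2) / 2) (by omega),
        ih ((m + 3) / 2) (by omega)]

/-- The closed form of `optEpl` at `L = ⌊log₂ n⌋`: `optEpl n = n⌊log₂ n⌋ + 2(n − 2^⌊log₂ n⌋)`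
(`n ≥ 1`), the `Λ₁^min` formula of [cite: SaoEtAl2026, Prop. 3.1]. -/
theorem optEpl_eq_log {n : ℕ} (hn : 1 ≤ n) :
    optEpl n = n * Nat.log 2 n + 2 * (n - 2 ^ Nat.log 2 n) := by
  set L := Nat.log 2 n
  have h1 : 2 ^ L ≤ n := Nat.pow_log_le_self 2 (by omega)
  have h2 : n < 2 ^ (L + 1) := Nat.lt_pow_succ_log_self (by norm_num) n
  have h := optEpl_closed L n h1 h2.le
  have e : 2 ^ (L + 1) = 2 * 2 ^ L := by ring
  rw [e] at h
  have : n * (L + 2) = n * L + 2 * n := by ring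
  omega

end Literature.ComputerArithmetic.SaoEtAl2026.SummationTree

end Part4

/-! ## Part 5 — the EXACT discharges `Shape.Lambda1Extrema_holds`, `Shape.Lambda1ExtremaAttained_holds` -/

namespace Literature.ComputerArithmetic.SaoEtAl2026.Shape

open SummationTree

/-- **The named fact `Shape.Lambda1Extrema` HOLDS** (`ReductionTrees.lean`; Sao et al. 2026 Prop. 3.1, the bounds: every full binary
tree with `k` leaves has `k⌊log₂ k⌋ + 2(k − 2^⌊log₂ k⌋) ≤ Λ₁` and `2Λ₁ + 2 ≤ k(k+1)`).  EXACT-name discharge by transport to a summation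
tree (`SummationTree.ofShape`), `optEpl_le_epl`, `two_mul_epl_le` and the closed form `optEpl_eq_log`.  Literature-side twin of the
Summits-side `Summit.Ventures.CertifiedArithmetic.LowPrec.SR.lambda1Extrema_holds`. [cite: SaoEtAl2026, Prop. 3.1] -/
theorem Lambda1Extrema_holds : Lambda1Extrema := by
  intro T
  have h1 := optEpl_le_epl (ofShape T)
  have h2 := two_mul_epl_le (ofShape T)
  rw [leaves_ofShape, epl_ofShape] at h1 h2
  exact ⟨(optEpl_eq_log (Shape.size_pos T)) ▸ h1, h2⟩

/-- **The named fact `Shape.Lambda1ExtremaAttained` HOLDS** (`ReductionTrees.lean`; Sao et al. 2026 Prop. 3.1, attainment: the halving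
tree on `k ≥ 1` leaves has `k` leaves and `Λ₁ = k⌊log₂ k⌋ + 2(k − 2^⌊log₂ k⌋)`; the sequential tree has `2Λ₁ + 2 = k(k+1)`).
EXACT-name discharge (`ofShape_halving`, `epl_pairwise`, `leaves_pairwise`, `optEpl_eq_log`, `lambda1ExtremaAttained_sequential`).
Literature-side twin of `Summit.Ventures.CertifiedArithmetic.LowPrec.SR.lambda1ExtremaAttained_holds`. [cite: SaoEtAl2026, Prop. 3.1] -/
theorem Lambda1ExtremaAttained_holds : Lambda1ExtremaAttained := by
  intro k hk
  have hs : (Shape.halving k).size = k := by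
    rw [← leaves_ofShape, ofShape_halving k 0, leaves_pairwise _ _ _ hk]
  refine ⟨hs, ?_, Shape.lambda1ExtremaAttained_sequential hk⟩
  rw [← epl_ofShape, ofShape_halving k 0, epl_pairwise _ _ _ hk, optEpl_eq_log hk]

end Literature.ComputerArithmetic.SaoEtAl2026.Shape

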